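import Summits.Parity.GeneralizedHardyLittlewood.Theorems.LeeYangFibresCellParityLawDefs
import HarnessLib

/-!
# Route `LeeYangFibres`, crux `CellParityLaw` (stmt-Parity-14109), line `section-annihilator`:
# the registered stub `stub_lawOfPrLaw` — from Bombieri's `P_r` law to the section law

We prove the conversion `EulerRatioIdentity → ∀ t ≥ 1, SectionPrLawAt t → SectionLawAt t`
(vocabulary file `LeeYangFibresCellParityLawDefs`). `SectionPrLawAt t` is `SectionLawAt t`
VERBATIM except that the singular-series ratio `𝔖(Ψ)/𝔖(Ψ₋ᵢ)` in the model term is replaced by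
Bombieri's constant `H_{Ψ,i} = sectionH Ψ i` of the section density. The Euler-ratio identity says
that at scale `N ≥ N₀(t, L, u)`, for every non-degenerate system `Ψ` of size `≤ L` and every
coordinate `i`, either `𝔖(Ψ₋ᵢ) ≠ 0` and then `H_{Ψ,i} = 𝔖(Ψ)/𝔖(Ψ₋ᵢ)` (the two model terms are
literally equal), or `𝔖(Ψ₋ᵢ) = 0` and then every section mass `F⁽ⁱ⁾_{j'}` vanishes (both model
terms are `0`, and the two statements coincide again). Pure bookkeeping: take `N₀` the maximum of
the two thresholds and the same `δ`.
-/

noncomputable section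

open scoped BigOperators Classical
open Finset Filter Literature.NumberTheory.Sieve

namespace Summit.Parity.GeneralizedHardyLittlewood.Cruxes.CellParityLaw.SectionAnnihilator

/-- **`stub_lawOfPrLaw`** (registered stub of skeleton v8, line `section-annihilator`): the Euler-ratio
identity converts Bombieri's `P_r` law for the sections (constant `H_{Ψ,i}`) into the section law
(constant `𝔖(Ψ)/𝔖(Ψ₋ᵢ)`): off local obstructions the constants agree, on them the section masses
vanish and both model terms are `0`. -/
theorem stub_lawOfPrLaw : EulerRatioIdentity → ∀ t : ℕ, 1 ≤ t → SectionPrLawAt t → SectionLawAt t := by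
  intro hE t _ht hPr L u B hu
  obtain ⟨N₁, hN₁⟩ := hPr L u B hu
  obtain ⟨N₂, hN₂⟩ := hE t L u hu
  refine ⟨max N₁ N₂, fun N hN Ψ hΨ hL K hK hKN i j' hj' => ?_⟩
  obtain ⟨δ, h0, h2, hm⟩ := hN₁ N (le_of_max_le_left hN) Ψ hΨ hL K hK hKN i j' hj'
  refine ⟨δ, h0, h2, fun m hm1 hmu => ?_⟩
  have key := hm m hm1 hmu
  have hEi := hN₂ N (le_of_max_le_right hN) Ψ hΨ hL i
  by_cases hS : singularProduct (Fin.removeNth i Ψ) = 0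
  · have h0mass : sectionMass Ψ K N u i j' 1 = 0 := hEi.2 hS K j'
    rw [h0mass, Nat.cast_zero, mul_zero] at key
    rw [h0mass, Nat.cast_zero, mul_zero]
    exact key
  · rw [hEi.1 hS] at key
    exact key

end Summit.Parity.GeneralizedHardyLittlewood.Cruxes.CellParityLaw.SectionAnnihilator

end
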